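import Literature.AnabelianGeometry.SemiGraphs.TemperedPiDecomposition
import Literature.AnabelianGeometry.SemiGraphs.UniversalCoveringOverCountable
import Literature.AnabelianGeometry.SemiGraphs.MorphismsOver
import HarnessLib

/-!
# Decomposition homomorphisms `Π_e → π₁^temp(𝒢)` at compatible edge-point sequences ([SemiAnbd] §3 p. 41)

Mochizuki, *Semi-graphs of anabelioids*, Publ. RIMS **42** (2006), §3, Thm. 3.7 (iii) and its proof,
author's manuscript p. 41 [cite: MochizukiSemiAnbd2006, Thm 3.7(iii) p.41]: "this compact subgroup is
contained in the image of some `π̂₁(𝒢_e)`, for some edge `e` of `𝒢`. We shall refer to such images of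
'`π̂₁(𝒢_e)`'s' as the edge-like subgroups" and "if `H` fixes an edge, then it does not switch the branches
of the edge".

EDGE analogue of `TemperedPiDecomposition.lean` (seat abc-iut-L3-t6, row «DECOMP-E»; split with
abc-iut-L3-t8 gen 3 who holds the chart halves): for Galois level data `D` of a CONNECTED `𝒢` and a
compatible sequence `t n` of points of the EDGE fibres `(𝒢_{∞,n})_e` (`EdgeSeq`), the decomposition
homomorphism `decompHomE : Π_e →* π₁^temp(𝒢)` (`h ↦ (σ_n)`, `σ_n` moving `t n` to `h⁻¹ · t n`;
transitivity of `Aut(𝒢_{∞,n})` on edge fibres is deduced from the vertex fibres through the gluing along a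
branch, `exists_aut_apply_eqE`), continuous (`decompHomEcont`), whose image fixes the compatible edge
system `[t n]` of the trees (`treeAct_decompHomE_edgeMap`, tree half of (I3)/(I1) for edges).  The
converse containment and the existence of edge-point sequences are in the sequel.
Nothing here bears on [IUTchIII] Cor. 3.12.
-/

namespace Literature.AnabelianGeometry.SemiGraphs

namespace ProfiniteSemiGraph

namespace GaloisLevelData

open CategoryTheory Topology
open Literature.AlgebraicGeometry.Frobenioids.QuasiTemperoid (stabilizerSubgroup
  mem_stabilizerSubgroup_iff isOpen_stabilizerSubgroup)
open Literature.AlgebraicGeometry.Frobenioids.QuasiTemperoid.BTempConnected (ρ_one_apply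
  ρ_mul_apply ρ_inv_apply)

universe u

variable {𝒢 : ProfiniteSemiGraph.{u}} (D : GaloisLevelData 𝒢) (h𝒢 : 𝒢.IsCountable)

/-! ### Edge fibres of the tower -/

/-- Pointwise descent square on edge fibres. [cite: MochizukiSemiAnbd2006, Prop 3.6 p.38] -/
theorem stepCover_apply_autE (n : ℕ) (σ : D.Gal h𝒢 (n + 1)) {e : 𝒢.graph.Edge}
    (t : ((D.cover h𝒢 (n + 1)).SE e).obj.V) :
    ((D.stepCover h𝒢 n).fE e).hom.hom ((σ.hom.fE e).hom.hom t) =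
      ((D.step h𝒢 n σ).hom.fE e).hom.hom (((D.stepCover h𝒢 n).fE e).hom.hom t) :=
  congrArg (fun φ : D.cover h𝒢 (n + 1) ⟶ D.cover h𝒢 n => (φ.fE e).hom.hom t) (D.hom_comp_stepCover h𝒢 n σ)

/-- The covering maps of the tower are `Π_e`-equivariant on edge fibres. [cite: MochizukiSemiAnbd2006, Prop 3.6 p.38] -/
theorem stepCover_ρE (n : ℕ) {e : 𝒢.graph.Edge} (h : 𝒢.Ge e) (t : ((D.cover h𝒢 (n + 1)).SE e).obj.V) :
    ((D.stepCover h𝒢 n).fE e).hom.hom (((D.cover h𝒢 (n + 1)).SE e).obj.ρ h t) =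
      ((D.cover h𝒢 n).SE e).obj.ρ h (((D.stepCover h𝒢 n).fE e).hom.hom t) :=
  CovHom.fE_ρ (D.stepCover h𝒢 n) e h t

/-- Pointwise on edges: the edge of `𝔾̃_n` under the image of an edge point is the transition of the edge
under the point. [cite: MochizukiSemiAnbd2006, Thm 3.7(iii) p.41] -/
theorem treeStep_edgeMap_mk (n : ℕ) {e : 𝒢.graph.Edge} (t : ((D.cover h𝒢 (n + 1)).SE e).obj.V) :
    (D.treeStep n).edgeMap ((D.treeIso h𝒢 (n + 1)).hom.edgeMap (Quot.mk _ ⟨e, t⟩)) =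
      (D.treeIso h𝒢 n).hom.edgeMap (Quot.mk _ ⟨e, ((D.stepCover h𝒢 n).fE e).hom.hom t⟩) := by
  have h := congrArg (fun φ => SemiGraph.Hom.edgeMap φ (Quot.mk _ ⟨e, t⟩)) (D.orbitGraphMap_stepCover h𝒢 n)
  simp only [SemiGraph.comp_edgeMap, Function.comp_apply] at h
  exact h.symm

/-- The action of `σ ∈ Aut(𝒢_{∞,n})` on an edge of `𝔾̃_n` read through a point: `σ · [t] = [σ t]`.
[cite: MochizukiSemiAnbd2006, Thm 3.7(iii) p.41] -/
theorem galTreeAct_edgeMap_mk (n : ℕ) (σ : D.Gal h𝒢 n) {e : 𝒢.graph.Edge}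
    (t : ((D.cover h𝒢 n).SE e).obj.V) :
    (D.galTreeAct h𝒢 n σ).hom.edgeMap ((D.treeIso h𝒢 n).hom.edgeMap (Quot.mk _ ⟨e, t⟩)) =
      (D.treeIso h𝒢 n).hom.edgeMap (Quot.mk _ ⟨e, (σ.hom.fE e).hom.hom t⟩) := by
  have h1 : (D.galTreeAct h𝒢 n σ).hom = (D.treeIso h𝒢 n).inv ≫ CovObj.orbitGraphMap σ.hom ≫
      (D.treeIso h𝒢 n).hom := (D.S n).autUnivCover_hom (Sum.inl (D.W n)) h𝒢 σ
  have h2 : (D.treeIso h𝒢 n).inv.edgeMap ((D.treeIso h𝒢 n).hom.edgeMap (Quot.mk _ ⟨e, t⟩)) =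
      Quot.mk _ ⟨e, t⟩ :=
    congrArg (fun φ : (D.cover h𝒢 n).orbitGraph ⟶ (D.cover h𝒢 n).orbitGraph =>
      φ.edgeMap (Quot.mk (D.cover h𝒢 n).ERel ⟨e, t⟩)) (D.treeIso h𝒢 n).hom_inv_id
  rw [h1]
  exact congrArg
    (fun E => (D.treeIso h𝒢 n).hom.edgeMap ((CovObj.orbitGraphMap σ.hom).edgeMap E)) h2

/-- The edges of `𝒢_{∞,n}` (read in `𝔾̃_n`) are injectively labelled by their orbits.
[cite: MochizukiSemiAnbd2006, Prop 3.6 p.38] -/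
theorem mkE_eq_mkE_of_edgeMap_eq (n : ℕ) {e : 𝒢.graph.Edge} (t t' : ((D.cover h𝒢 n).SE e).obj.V)
    (h : (D.treeIso h𝒢 n).hom.edgeMap (Quot.mk _ ⟨e, t⟩) =
      (D.treeIso h𝒢 n).hom.edgeMap (Quot.mk _ ⟨e, t'⟩)) :
    (Quot.mk (D.cover h𝒢 n).ERel ⟨e, t⟩ : (D.cover h𝒢 n).OEdge) = Quot.mk _ ⟨e, t'⟩ :=
  (D.S n).univCoverOverEdge_injective (Sum.inl (D.W n)) h𝒢 h

/-- **`Aut(𝒢_{∞,n})` acts transitively on every EDGE fibre** (for connected `𝔾`): glue the two edge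
points along a branch of `e` abutting to a vertex, move the glued points by an automorphism (vertex
transitivity), and unglue (the gluing is injective and compatible with morphisms).
[cite: MochizukiSemiAnbd2006, Prop 3.6 p.38] -/
theorem exists_aut_apply_eqE (hc : 𝒢.graph.IsConnected) (n : ℕ) {e : 𝒢.graph.Edge}
    (t t' : ((D.cover h𝒢 n).SE e).obj.V) :
    ∃ η : D.Gal h𝒢 n, (η.hom.fE e).hom.hom t = t' := by
  obtain ⟨b, hbe, hb⟩ := SemiGraph.exists_abuts_of_isConnected hc D.v₀ e
  subst hbe
  obtain ⟨w, hw⟩ := Option.isSome_iff_exists.mp hb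
  obtain ⟨η, hη⟩ := (D.S n).exists_aut_apply_eq' h𝒢 (D.W n) (D.htrans n)
    (((D.cover h𝒢 n).glue b w hw).hom.hom.hom t) (((D.cover h𝒢 n).glue b w hw).hom.hom.hom t')
  refine ⟨η, (D.cover h𝒢 n).glue_injective b w hw ?_⟩
  change ((D.cover h𝒢 n).glue b w hw).hom.hom.hom ((η.hom.fE _).hom.hom t) =
    ((D.cover h𝒢 n).glue b w hw).hom.hom.hom t'
  exact (CovHom.glue_fE η.hom b w hw t).trans hη

/-! ### Compatible edge-point sequences -/

/-- **A compatible sequence of points of the EDGE fibres** over `e` of the tower `𝒢_{∞,n}`.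
[cite: MochizukiSemiAnbd2006, Thm 3.7(iii) p.41] -/
structure EdgeSeq (e : 𝒢.graph.Edge) : Type u where
  /-- the points -/
  pt : ∀ n : ℕ, ((D.cover h𝒢 n).SE e).obj.V
  /-- compatibility under the covering maps of the tower -/
  compat : ∀ n, ((D.stepCover h𝒢 n).fE e).hom.hom (pt (n + 1)) = pt n

namespace EdgeSeq

variable {D h𝒢} {e : 𝒢.graph.Edge} (T : D.EdgeSeq h𝒢 e) (hc : 𝒢.graph.IsConnected)

/-- The edge of the tree `𝔾̃_n` under the `n`-th point. [cite: MochizukiSemiAnbd2006, Thm 3.7(iii) p.41] -/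
noncomputable def edge (n : ℕ) : (D.tree n).Edge :=
  (D.treeIso h𝒢 n).hom.edgeMap (Quot.mk _ ⟨e, T.pt n⟩)

/-- The edges under a compatible edge-point sequence form a compatible edge system.
[cite: MochizukiSemiAnbd2006, Thm 3.7(iii) p.41] -/
theorem treeStep_edge (n : ℕ) : (D.treeStep n).edgeMap (T.edge (n + 1)) = T.edge n := by
  unfold edge
  rw [D.treeStep_edgeMap_mk h𝒢 n, T.compat n]

/-- Compatibility for all `i ≤ j`. [cite: MochizukiSemiAnbd2006, Thm 3.7(iii) p.41] -/
theorem treeTrans_edge {i j : ℕ} (h : i ≤ j) : (D.treeTrans h).edgeMap (T.edge j) = T.edge i := by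
  induction j, h using Nat.le_induction with
  | base => rw [D.treeTrans_self]; rfl
  | succ k h ih => rw [D.treeTrans_succ h, SemiGraph.comp_edgeMap, Function.comp_apply, T.treeStep_edge, ih]

/-! ### The automorphisms `σ_n^h` for `h ∈ Π_e` -/

include hc

/-- For `h ∈ Π_e`: the automorphism of `𝒢_{∞,n}` moving `t n` to `h⁻¹ · t n`.
[cite: MochizukiSemiAnbd2006, Thm 3.7(iii) p.41] -/
noncomputable def galE (n : ℕ) (h : 𝒢.Ge e) : D.Gal h𝒢 n :=
  (D.exists_aut_apply_eqE h𝒢 hc n (T.pt n) (((D.cover h𝒢 n).SE e).obj.ρ h⁻¹ (T.pt n))).choose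

/-- The defining property of `σ_n^h`. [cite: MochizukiSemiAnbd2006, Thm 3.7(iii) p.41] -/
theorem galE_apply (n : ℕ) (h : 𝒢.Ge e) :
    (((T.galE hc n h).hom.fE e).hom.hom (T.pt n)) = ((D.cover h𝒢 n).SE e).obj.ρ h⁻¹ (T.pt n) :=
  (D.exists_aut_apply_eqE h𝒢 hc n (T.pt n) (((D.cover h𝒢 n).SE e).obj.ρ h⁻¹ (T.pt n))).choose_spec

/-- Uniqueness (edge rigidity of `𝒢_{∞,n}`). [cite: MochizukiSemiAnbd2006, Thm 3.7(iii) p.41] -/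
theorem eq_galE (n : ℕ) (h : 𝒢.Ge e) (η : D.Gal h𝒢 n)
    (hη : (η.hom.fE e).hom.hom (T.pt n) = ((D.cover h𝒢 n).SE e).obj.ρ h⁻¹ (T.pt n)) : η = T.galE hc n h :=
  Iso.ext ((D.S n).univCoverOver_hom_ext_edge (Sum.inl (D.W n)) h𝒢 _ _ (T.pt n)
    (hη.trans (T.galE_apply hc n h).symm))

/-- `σ_n^1 = 1`. [cite: MochizukiSemiAnbd2006, Thm 3.7(iii) p.41] -/
theorem galE_one (n : ℕ) : T.galE hc n 1 = 1 :=
  (T.eq_galE hc n 1 1 (by rw [inv_one, ρ_one_apply]; rfl)).symm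

/-- `σ_n^{hh'} = σ_n^h σ_n^{h'}`. [cite: MochizukiSemiAnbd2006, Thm 3.7(iii) p.41] -/
theorem galE_mul (n : ℕ) (h h' : 𝒢.Ge e) : T.galE hc n (h * h') = T.galE hc n h * T.galE hc n h' := by
  symm
  apply T.eq_galE hc
  change ((T.galE hc n h).hom.fE e).hom.hom (((T.galE hc n h').hom.fE e).hom.hom (T.pt n)) = _
  rw [T.galE_apply hc n h', CovHom.fE_ρ, T.galE_apply hc n h, ← ρ_mul_apply, mul_inv_rev]

/-- `step (σ_{n+1}^h) = σ_n^h`. [cite: MochizukiSemiAnbd2006, Prop 3.6 p.38] -/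
theorem step_galE (n : ℕ) (h : 𝒢.Ge e) : D.step h𝒢 n (T.galE hc (n + 1) h) = T.galE hc n h := by
  apply T.eq_galE hc
  rw [← T.compat n, ← D.stepCover_apply_autE h𝒢 n, T.galE_apply hc (n + 1) h, D.stepCover_ρE h𝒢 n]

/-! ### The decomposition homomorphism at an edge-point sequence -/

/-- **The decomposition homomorphism `Π_e → π₁^temp(𝒢)` at the compatible edge-point sequence `t`.**
[cite: MochizukiSemiAnbd2006, Thm 3.7(iii) p.41] -/
noncomputable def decompHomE : 𝒢.Ge e →* D.temperedPi h𝒢 where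
  toFun h := D.mkPi h𝒢 (fun n => T.galE hc n h) (fun n => T.step_galE hc n h)
  map_one' := D.pi_ext h𝒢 fun n => by
    rw [D.proj_mkPi h𝒢, map_one]
    exact T.galE_one hc n
  map_mul' h h' := D.pi_ext h𝒢 fun n => by
    rw [D.proj_mkPi h𝒢, map_mul, D.proj_mkPi h𝒢, D.proj_mkPi h𝒢]
    exact T.galE_mul hc n h h'

/-- The projections of the edge decomposition homomorphism. [cite: MochizukiSemiAnbd2006, Thm 3.7(iii) p.41] -/
theorem proj_decompHomE (n : ℕ) (h : 𝒢.Ge e) : D.proj h𝒢 n ((T.decompHomE hc) h) = T.galE hc n h := rfl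

/-- The defining property on the point sequence: the `n`-th component of `decompHomE h` moves `t n` to
`h⁻¹ · t n`. [cite: MochizukiSemiAnbd2006, Thm 3.7(iii) p.41] -/
theorem proj_decompHomE_apply (n : ℕ) (h : 𝒢.Ge e) :
    (((D.proj h𝒢 n ((T.decompHomE hc) h)).hom.fE e).hom.hom (T.pt n)) =
      ((D.cover h𝒢 n).SE e).obj.ρ h⁻¹ (T.pt n) :=
  T.galE_apply hc n h

/-- Characterisation of `decompHomE h` by its action on the point sequence.
[cite: MochizukiSemiAnbd2006, Thm 3.7(iii) p.41] -/
theorem eq_decompHomE (g : D.temperedPi h𝒢) (h : 𝒢.Ge e)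
    (hg : ∀ n, (((D.proj h𝒢 n g).hom.fE e).hom.hom (T.pt n)) = ((D.cover h𝒢 n).SE e).obj.ρ h⁻¹ (T.pt n)) :
    g = (T.decompHomE hc) h :=
  D.pi_ext h𝒢 fun n => T.eq_galE hc n h _ (hg n)

/-- The kernel of the `n`-th component is the stabiliser of `t n` in `Π_e`.
[cite: MochizukiSemiAnbd2006, Thm 3.7(iii) p.41] -/
theorem galE_eq_one_iff (n : ℕ) (h : 𝒢.Ge e) :
    T.galE hc n h = 1 ↔ ((D.cover h𝒢 n).SE e).obj.ρ h (T.pt n) = T.pt n := by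
  constructor
  · intro h1
    have h2 := T.galE_apply hc n h
    rw [h1] at h2
    change T.pt n = _ at h2
    have h3 := congrArg (((D.cover h𝒢 n).SE e).obj.ρ h) h2
    rw [← ρ_mul_apply, mul_inv_cancel, ρ_one_apply] at h3
    exact h3
  · intro h1
    symm
    apply T.eq_galE hc
    change T.pt n = _
    calc T.pt n = ((D.cover h𝒢 n).SE e).obj.ρ h⁻¹ (((D.cover h𝒢 n).SE e).obj.ρ h (T.pt n)) :=
        (ρ_inv_apply _ h _).symm
      _ = ((D.cover h𝒢 n).SE e).obj.ρ h⁻¹ (T.pt n) := by rw [h1]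

/-- **The edge decomposition homomorphism is continuous.** [cite: MochizukiSemiAnbd2006, Thm 3.7(iii) p.41] -/
theorem continuous_decompHomE : Continuous (T.decompHomE hc) := by
  refine continuous_induced_rng.2 (continuous_pi fun i => ?_)
  obtain ⟨n⟩ := i
  change Continuous fun h => T.galE hc n h
  refine continuous_discrete_rng.2 fun b => ?_
  by_cases hb : ∃ h₀, T.galE hc n h₀ = b
  · obtain ⟨h₀, rfl⟩ := hb
    have hset : (fun h => T.galE hc n h) ⁻¹' {T.galE hc n h₀} =
        (fun h => h₀⁻¹ * h) ⁻¹' (stabilizerSubgroup ((D.cover h𝒢 n).SE e) (T.pt n) : Set (𝒢.Ge e)) := by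
      ext h
      simp only [Set.mem_preimage, Set.mem_singleton_iff, SetLike.mem_coe, mem_stabilizerSubgroup_iff]
      rw [← T.galE_eq_one_iff hc]
      change ((D.proj h𝒢 n).comp (T.decompHomE hc)) h = ((D.proj h𝒢 n).comp (T.decompHomE hc)) h₀ ↔
        ((D.proj h𝒢 n).comp (T.decompHomE hc)) (h₀⁻¹ * h) = 1
      rw [map_mul, map_inv, inv_mul_eq_one, eq_comm]
    rw [hset]
    exact (isOpen_stabilizerSubgroup _ _).preimage (continuous_const.mul continuous_id)
  · have hset : (fun h => T.galE hc n h) ⁻¹' {b} = ∅ :=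
      Set.eq_empty_iff_forall_notMem.mpr fun h hh => hb ⟨h, hh⟩
    rw [hset]
    exact isOpen_empty

/-- The edge decomposition homomorphism as a continuous homomorphism `Π_e →ₜ* π₁^temp(𝒢)`.
[cite: MochizukiSemiAnbd2006, Thm 3.7(iii) p.41] -/
noncomputable def decompHomEcont : 𝒢.Ge e →ₜ* D.temperedPi h𝒢 :=
  ⟨T.decompHomE hc, T.continuous_decompHomE hc⟩

/-- `decompHomEcont` is `decompHomE`. [cite: MochizukiSemiAnbd2006, Thm 3.7(iii) p.41] -/
theorem decompHomEcont_toMonoidHom : (T.decompHomEcont hc).toMonoidHom = T.decompHomE hc := rfl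

/-! ### (I3)/(I1) for edges, tree half: the image of `Π_e` fixes the edge system -/

/-- **The image of `Π_e` under the edge decomposition homomorphism fixes the compatible edge system
`[t n]` of the trees.** [cite: MochizukiSemiAnbd2006, Thm 3.7(iii) p.41] -/
theorem treeAct_decompHomE_edgeMap (n : ℕ) (h : 𝒢.Ge e) :
    (D.treeAct h𝒢 n ((T.decompHomE hc) h)).hom.edgeMap (T.edge n) = T.edge n := by
  rw [D.treeAct_apply, T.proj_decompHomE hc]
  unfold edge
  rw [D.galTreeAct_edgeMap_mk h𝒢 n (T.galE hc n h) (T.pt n), T.galE_apply hc]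
  exact congrArg _ (Quot.sound (CovObj.ERel.mk (S := D.cover h𝒢 n) e h⁻¹ (T.pt n))).symm

/-- The image of `Π_e` also fixes the BRANCHES of the edges `[t n]` (the action is over `𝔾`: "if `H`
fixes an edge, then it does not switch the branches of the edge", p. 41).
[cite: MochizukiSemiAnbd2006, Thm 3.7(iii) p.41] -/
theorem treeAct_decompHomE_branchMap (n : ℕ) (h : 𝒢.Ge e) (b : (D.tree n).Branch)
    (hb : (D.tree n).edgeOf b = T.edge n) :
    (D.treeAct h𝒢 n ((T.decompHomE hc) h)).hom.branchMap b = b :=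
  SemiGraph.branchMap_eq_of_over_aut (D.treeProj n) (D.treeAct h𝒢 n ((T.decompHomE hc) h))
    (D.treeAct_over h𝒢 n _) b (by rw [hb]; exact T.treeAct_decompHomE_edgeMap hc n h)

end EdgeSeq

end GaloisLevelData

end ProfiniteSemiGraph

end Literature.AnabelianGeometry.SemiGraphs
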